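import Summits.BirchSwinnertonDyer.Rank1Residual.X10.MuTransferThreeOfFineShaCells
import HarnessLib

/-!
# Class X10b (N2), the F1 ROAD at `p = 3`: per-cell kernel RECORDS for Ш-CELLS, part 02 — Miller's `BSD(E,3)`
# AT THE PAIR modulo Kato's zeta-element package F1 + PUBLISHED named facts + displayed census / certificate binders,
# for 6 N2 cells with `#Ш_an = 9` that carry an exact `3`-descent `#Sel^(3)(E/ℚ) = 9` of record (186050n1, 305762d1, 322624k1, 327184dt1, 340186p1, 427130j1)
# (cell `b2b-bsdres`, unit `b2b-bsdres-x10` = N2 class lead, GEN 41; records — theorems only, no definition,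
# no named fact, nothing booked)

HONEST FRAMING (run/shared/lean/b2b/bsd-rank1-residual/, verbatim in every file): the goal of the
cell is to DELETE the COMBINATION-SHAPED residual classes of the Birch–Swinnerton-Dyer formula for
ALL analytic-rank `≤ 1` elliptic curves over `ℚ` — "full BSD formula for every rank `≤ 1` curve in
class `C`" assembled STRICTLY from published theorems — so that the rank-`≤ 1` remainder becomes
exactly the CONSTRUCTION-SHAPED classes, which are TYPED (missing-input `Prop`s), NOT attempted.
This is not "finishing BSD". Class X10b keeps its label CONSTRUCTION-SHAPED (NEEDS X_A3, RESIDUAL-MAP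
§I N2); nothing is booked by this file (the lane books, the referee rules); everything is PER PAIR — a
SECOND ROAD for cells whose road of record is the CTP road `X10/CasselsTatePairingRecords*` (GEN 19–21).

## What (x10 GEN 41, X10-AUDIT §47; TOOL `X10/MuTransferThreeOfFineShaCells.lean`)

For each Ш-cell `E` below (analytic rank `0`, `#Ш(E/ℚ)_an = 9`; Cremona minimal model; `3 ∤ Δ`, ordinary point
count at `3` and an `E[3]`-irreducibility witness DECIDED in the kernel, EITHER image): Miller's `BSD(E,3)` from
F1 (`hfine`: the UPPER half `ord₃ #Ш ≤ ord₃ #Ш_an` via Kato 17.4-from-F1 + the `μ`-transfer) and ONE exact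
`3`-descent `hcard : #Sel^(3)(E/ℚ) = 9` (the LOWER half: at rank `0` with `E[3]` irreducible,
`#(Ш ⊓ H¹(ℚ,E)[3]) = #Sel^(3)`, Silverman X.4.2 (a), so `9 ∣ #Ш`) — NO Cassels–Tate pairing certificate, NO
Cassels–Tate squareness, NO Wuthrich.  DISPLAYED: F1; PUBLISHED `hS` (A35), `hmodP` (A19), `hGZK` (A18), `h3`
(A25); census / certificates `hL` (`L(E,1) ≠ 0`), `hcertA` (MUCERT3, three engines), `hcard` (the two-engine
exact `3`-descent of record, T2-BATCH-G10 / `X10/CasselsTatePairingRecords*`), `hq`/`hv` (`#Ш_an = 9`, Cremona).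

References: [Kato2004Asterisque] Thm. 12.6, Thm. 17.4, §17.13; [SilvermanAEC2009] Thm. X.4.2 (a);
[GreenbergLNM1716] Thm. 4.1; [Mazur1978] Prop. 6.3 (1); [Miller2011LMS] Def. 1.1; [Cremona2006] tables.
-/

set_option autoImplicit false

noncomputable section

open scoped Classical MatrixGroups ModularForm

open CongruenceSubgroup WeierstrassCurve Field Literature.NumberTheory.EllipticCurves
  Literature.NumberTheory.EllipticCurves.ModularForms Literature.NumberTheory.EllipticCurves.Rank1Residual
  Literature.NumberTheory.EllipticCurves.Kato2004
  Literature.NumberTheory.EllipticCurves.Rank1Residual.X11RankOneCertificates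
  Summit.BirchSwinnertonDyer.BirchSwinnertonDyer.Rank1Residual.IntModel
  Summit.BirchSwinnertonDyer.BirchSwinnertonDyer.Theorems.Rank1ResidualX1Defs
  Summit.BirchSwinnertonDyer.BirchSwinnertonDyer.Rank1Residual

namespace Summit.BirchSwinnertonDyer.Rank1Residual.X10.MuZeroRoad

/-! ### `186050n1` (3Ns, `N = 186050 = 2·5^2·61^2`, analytic rank `0`, `#Ш_an = 9` — Ш-CELL) -/

/-- **`BSD(E,3)` AT THE PAIR `(186050n1, 3)` MODULO F1 + PUBLISHED FACTS + CERTIFICATES — Ш-cell on the F1 road**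
(`MuZeroRoad.bsdp_three_shaCell_of_ainvs_of_fine_of_card_selmerThree`: F1 upper half + ONE exact `3`-descent lower
half; NO CTP pairing certificate). Cremona model `[1, 0, 1, -1536851, -5254416402]`, `N = 186050 = 2·5^2·61^2`, census image `3Ns`; IN THE KERNEL:
`3 ∤ Δ`, `#Ẽ(𝔽₃) = 6` (`a₃ = -2`: good ORDINARY, ANOMALOUS), Frobenius witness `ℓ = 7`: `ℓ ∤ Δ`, `#Ẽ(𝔽_{7}) = 5`
(`a_{7} = 3`), `X² − a_{7}X + 7` root-free mod `3` (`E[3]` irreducible). Cremona `allbsd`: analytic rank `0`,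
`#E(ℚ)_tors = 1`, `∏ c_ℓ = 4`, `#Ш_an = 9`. DISPLAYED: F1 (`hfine`); PUBLISHED `hS`, `hmodP`, `hGZK`, `h3`; census /
certificates `hL`, `hcertA` (MUCERT3), `hcard` (`#Sel^(3)(E/ℚ) = 9`, the two-engine exact `3`-descent of record — the
same binder as the CTP record `bsdp_t186050n1`), `hq`/`hv` (`ord₃ #Ш_an = 2`). Second road; per pair; nothing booked.
[cite: Kato2004Asterisque, Thm. 12.6 (p. 222), Thm. 17.4 (2), (3) (p. 273) and §17.13 (pp. 279–280)]
[cite: SilvermanAEC2009, Thm. X.4.2 (a)] [cite: Mazur1978, §6 Prop. 6.3 (1) (p. 153)]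
[cite: Miller2011LMS, Def. 1.1 (arXiv:1010.2431 p. 3)] [cite: Cremona2006, Table 1 (Cremona label 186050n1)] -/
theorem bsdp_three_sha_e186050n1_of_fine
    (hfine : exists_divisibilityInputs_fineQuotient_zeta)
    (hS : Schneider1985_order_charGenerator_odd) (hmodP : nonempty_modularParametrizationData)
    (hGZK : rank_eq_analyticRank_of_analyticRank_le_one) (h3 : realPeriodRat_eq_unit_mul_plusPeriod_three)
    (W : WeierstrassCurve ℚ) [W.IsElliptic] [W.IsGloballyMinimal]
    (hI : integralModelInt W = ⟨1, 0, 1, (-1536851), (-5254416402)⟩) (hL : W.entireLFunction 1 ≠ 0)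
    (hcertA : ∀ {N : ℕ} [NeZero N] (f : CuspForm (Gamma0 N) 2), IsNewformOf W f →
      ∃ n : ℕ, ‖PowerSeries.coeff n (padicLFunction f (unitRoot W 3 : ℚ_[3]))‖ = 1)
    (hcard : Nat.card (W.selmerGroup (3 : ℤ)) = 9)
    {q : ℚ} (hq : shaAn W = (q : ℂ)) (hv : padicValRat 3 q = 2) : BSDp W 3 :=
  haveI : Fact (Nat.Prime 7) := ⟨by norm_num⟩
  bsdp_three_shaCell_of_ainvs_of_fine_of_card_selmerThree hfine hS hmodP hGZK h3 1 0 1 (-1536851) (-5254416402) hI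
    7 5 6 (by decide +kernel) (by decide +kernel) (by decide) (by decide) (by decide) (by decide +kernel)
    (by decide +kernel) (by decide +kernel) hL hcertA hcard hq hv.le

/-! ### `305762d1` (3Ns, `N = 305762 = 2·17^2·23^2`, analytic rank `0`, `#Ш_an = 9` — Ш-CELL) -/

/-- **`BSD(E,3)` AT THE PAIR `(305762d1, 3)` MODULO F1 + PUBLISHED FACTS + CERTIFICATES — Ш-cell on the F1 road**
(`MuZeroRoad.bsdp_three_shaCell_of_ainvs_of_fine_of_card_selmerThree`: F1 upper half + ONE exact `3`-descent lower
half; NO CTP pairing certificate). Cremona model `[1, 1, 0, -165191105, -959737799051]`, `N = 305762 = 2·17^2·23^2`, census image `3Ns`; IN THE KERNEL: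
`3 ∤ Δ`, `#Ẽ(𝔽₃) = 5` (`a₃ = -1`: good ORDINARY), Frobenius witness `ℓ = 7`: `ℓ ∤ Δ`, `#Ẽ(𝔽_{7}) = 5`
(`a_{7} = 3`), `X² − a_{7}X + 7` root-free mod `3` (`E[3]` irreducible). Cremona `allbsd`: analytic rank `0`,
`#E(ℚ)_tors = 1`, `∏ c_ℓ = 4`, `#Ш_an = 9`. DISPLAYED: F1 (`hfine`); PUBLISHED `hS`, `hmodP`, `hGZK`, `h3`; census /
certificates `hL`, `hcertA` (MUCERT3), `hcard` (`#Sel^(3)(E/ℚ) = 9`, the two-engine exact `3`-descent of record — the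
same binder as the CTP record `bsdp_t305762d1`), `hq`/`hv` (`ord₃ #Ш_an = 2`). Second road; per pair; nothing booked.
[cite: Kato2004Asterisque, Thm. 12.6 (p. 222), Thm. 17.4 (2), (3) (p. 273) and §17.13 (pp. 279–280)]
[cite: SilvermanAEC2009, Thm. X.4.2 (a)] [cite: Mazur1978, §6 Prop. 6.3 (1) (p. 153)]
[cite: Miller2011LMS, Def. 1.1 (arXiv:1010.2431 p. 3)] [cite: Cremona2006, Table 1 (Cremona label 305762d1)] -/
theorem bsdp_three_sha_e305762d1_of_fine
    (hfine : exists_divisibilityInputs_fineQuotient_zeta)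
    (hS : Schneider1985_order_charGenerator_odd) (hmodP : nonempty_modularParametrizationData)
    (hGZK : rank_eq_analyticRank_of_analyticRank_le_one) (h3 : realPeriodRat_eq_unit_mul_plusPeriod_three)
    (W : WeierstrassCurve ℚ) [W.IsElliptic] [W.IsGloballyMinimal]
    (hI : integralModelInt W = ⟨1, 1, 0, (-165191105), (-959737799051)⟩) (hL : W.entireLFunction 1 ≠ 0)
    (hcertA : ∀ {N : ℕ} [NeZero N] (f : CuspForm (Gamma0 N) 2), IsNewformOf W f →
      ∃ n : ℕ, ‖PowerSeries.coeff n (padicLFunction f (unitRoot W 3 : ℚ_[3]))‖ = 1)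
    (hcard : Nat.card (W.selmerGroup (3 : ℤ)) = 9)
    {q : ℚ} (hq : shaAn W = (q : ℂ)) (hv : padicValRat 3 q = 2) : BSDp W 3 :=
  haveI : Fact (Nat.Prime 7) := ⟨by norm_num⟩
  bsdp_three_shaCell_of_ainvs_of_fine_of_card_selmerThree hfine hS hmodP hGZK h3 1 1 0 (-165191105) (-959737799051) hI
    7 5 5 (by decide +kernel) (by decide +kernel) (by decide) (by decide) (by decide) (by decide +kernel)
    (by decide +kernel) (by decide +kernel) hL hcertA hcard hq hv.le

/-! ### `322624k1` (3Ns, `N = 322624 = 2^6·71^2`, analytic rank `0`, `#Ш_an = 9` — Ш-CELL) -/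

/-- **`BSD(E,3)` AT THE PAIR `(322624k1, 3)` MODULO F1 + PUBLISHED FACTS + CERTIFICATES — Ш-cell on the F1 road**
(`MuZeroRoad.bsdp_three_shaCell_of_ainvs_of_fine_of_card_selmerThree`: F1 upper half + ONE exact `3`-descent lower
half; NO CTP pairing certificate). Cremona model `[0, -1, 0, -45335393, -116524739615]`, `N = 322624 = 2^6·71^2`, census image `3Ns`; IN THE KERNEL:
`3 ∤ Δ`, `#Ẽ(𝔽₃) = 5` (`a₃ = -1`: good ORDINARY), Frobenius witness `ℓ = 7`: `ℓ ∤ Δ`, `#Ẽ(𝔽_{7}) = 5`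
(`a_{7} = 3`), `X² − a_{7}X + 7` root-free mod `3` (`E[3]` irreducible). Cremona `allbsd`: analytic rank `0`,
`#E(ℚ)_tors = 1`, `∏ c_ℓ = 4`, `#Ш_an = 9`. DISPLAYED: F1 (`hfine`); PUBLISHED `hS`, `hmodP`, `hGZK`, `h3`; census /
certificates `hL`, `hcertA` (MUCERT3), `hcard` (`#Sel^(3)(E/ℚ) = 9`, the two-engine exact `3`-descent of record — the
same binder as the CTP record `bsdp_t322624k1`), `hq`/`hv` (`ord₃ #Ш_an = 2`). Second road; per pair; nothing booked.
[cite: Kato2004Asterisque, Thm. 12.6 (p. 222), Thm. 17.4 (2), (3) (p. 273) and §17.13 (pp. 279–280)]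
[cite: SilvermanAEC2009, Thm. X.4.2 (a)] [cite: Mazur1978, §6 Prop. 6.3 (1) (p. 153)]
[cite: Miller2011LMS, Def. 1.1 (arXiv:1010.2431 p. 3)] [cite: Cremona2006, Table 1 (Cremona label 322624k1)] -/
theorem bsdp_three_sha_e322624k1_of_fine
    (hfine : exists_divisibilityInputs_fineQuotient_zeta)
    (hS : Schneider1985_order_charGenerator_odd) (hmodP : nonempty_modularParametrizationData)
    (hGZK : rank_eq_analyticRank_of_analyticRank_le_one) (h3 : realPeriodRat_eq_unit_mul_plusPeriod_three)
    (W : WeierstrassCurve ℚ) [W.IsElliptic] [W.IsGloballyMinimal]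
    (hI : integralModelInt W = ⟨0, (-1), 0, (-45335393), (-116524739615)⟩) (hL : W.entireLFunction 1 ≠ 0)
    (hcertA : ∀ {N : ℕ} [NeZero N] (f : CuspForm (Gamma0 N) 2), IsNewformOf W f →
      ∃ n : ℕ, ‖PowerSeries.coeff n (padicLFunction f (unitRoot W 3 : ℚ_[3]))‖ = 1)
    (hcard : Nat.card (W.selmerGroup (3 : ℤ)) = 9)
    {q : ℚ} (hq : shaAn W = (q : ℂ)) (hv : padicValRat 3 q = 2) : BSDp W 3 :=
  haveI : Fact (Nat.Prime 7) := ⟨by norm_num⟩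
  bsdp_three_shaCell_of_ainvs_of_fine_of_card_selmerThree hfine hS hmodP hGZK h3 0 (-1) 0 (-45335393) (-116524739615) hI
    7 5 5 (by decide +kernel) (by decide +kernel) (by decide) (by decide) (by decide) (by decide +kernel)
    (by decide +kernel) (by decide +kernel) hL hcertA hcard hq hv.le

/-! ### `327184dt1` (3Ns, `N = 327184 = 2^4·11^2·13^2`, analytic rank `0`, `#Ш_an = 9` — Ш-CELL) -/

/-- **`BSD(E,3)` AT THE PAIR `(327184dt1, 3)` MODULO F1 + PUBLISHED FACTS + CERTIFICATES — Ш-cell on the F1 road**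
(`MuZeroRoad.bsdp_three_shaCell_of_ainvs_of_fine_of_card_selmerThree`: F1 upper half + ONE exact `3`-descent lower
half; NO CTP pairing certificate). Cremona model `[0, 1, 0, 974736, -1134484012]`, `N = 327184 = 2^4·11^2·13^2`, census image `3Ns`; IN THE KERNEL:
`3 ∤ Δ`, `#Ẽ(𝔽₃) = 3` (`a₃ = 1`: good ORDINARY, ANOMALOUS), Frobenius witness `ℓ = 7`: `ℓ ∤ Δ`, `#Ẽ(𝔽_{7}) = 5`
(`a_{7} = 3`), `X² − a_{7}X + 7` root-free mod `3` (`E[3]` irreducible). Cremona `allbsd`: analytic rank `0`,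
`#E(ℚ)_tors = 1`, `∏ c_ℓ = 8`, `#Ш_an = 9`. DISPLAYED: F1 (`hfine`); PUBLISHED `hS`, `hmodP`, `hGZK`, `h3`; census /
certificates `hL`, `hcertA` (MUCERT3), `hcard` (`#Sel^(3)(E/ℚ) = 9`, the two-engine exact `3`-descent of record — the
same binder as the CTP record `bsdp_t327184dt1`), `hq`/`hv` (`ord₃ #Ш_an = 2`). Second road; per pair; nothing booked.
[cite: Kato2004Asterisque, Thm. 12.6 (p. 222), Thm. 17.4 (2), (3) (p. 273) and §17.13 (pp. 279–280)]
[cite: SilvermanAEC2009, Thm. X.4.2 (a)] [cite: Mazur1978, §6 Prop. 6.3 (1) (p. 153)]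
[cite: Miller2011LMS, Def. 1.1 (arXiv:1010.2431 p. 3)] [cite: Cremona2006, Table 1 (Cremona label 327184dt1)] -/
theorem bsdp_three_sha_e327184dt1_of_fine
    (hfine : exists_divisibilityInputs_fineQuotient_zeta)
    (hS : Schneider1985_order_charGenerator_odd) (hmodP : nonempty_modularParametrizationData)
    (hGZK : rank_eq_analyticRank_of_analyticRank_le_one) (h3 : realPeriodRat_eq_unit_mul_plusPeriod_three)
    (W : WeierstrassCurve ℚ) [W.IsElliptic] [W.IsGloballyMinimal]
    (hI : integralModelInt W = ⟨0, 1, 0, 974736, (-1134484012)⟩) (hL : W.entireLFunction 1 ≠ 0)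
    (hcertA : ∀ {N : ℕ} [NeZero N] (f : CuspForm (Gamma0 N) 2), IsNewformOf W f →
      ∃ n : ℕ, ‖PowerSeries.coeff n (padicLFunction f (unitRoot W 3 : ℚ_[3]))‖ = 1)
    (hcard : Nat.card (W.selmerGroup (3 : ℤ)) = 9)
    {q : ℚ} (hq : shaAn W = (q : ℂ)) (hv : padicValRat 3 q = 2) : BSDp W 3 :=
  haveI : Fact (Nat.Prime 7) := ⟨by norm_num⟩
  bsdp_three_shaCell_of_ainvs_of_fine_of_card_selmerThree hfine hS hmodP hGZK h3 0 1 0 974736 (-1134484012) hI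
    7 5 3 (by decide +kernel) (by decide +kernel) (by decide) (by decide) (by decide) (by decide +kernel)
    (by decide +kernel) (by decide +kernel) hL hcertA hcard hq hv.le

/-! ### `340186p1` (3Ns, `N = 340186 = 2·7·11·47^2`, analytic rank `0`, `#Ш_an = 9` — Ш-CELL) -/

/-- **`BSD(E,3)` AT THE PAIR `(340186p1, 3)` MODULO F1 + PUBLISHED FACTS + CERTIFICATES — Ш-cell on the F1 road**
(`MuZeroRoad.bsdp_three_shaCell_of_ainvs_of_fine_of_card_selmerThree`: F1 upper half + ONE exact `3`-descent lower
half; NO CTP pairing certificate). Cremona model `[1, 0, 0, -13183358, -18680240740]`, `N = 340186 = 2·7·11·47^2`, census image `3Ns`; IN THE KERNEL: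
`3 ∤ Δ`, `#Ẽ(𝔽₃) = 3` (`a₃ = 1`: good ORDINARY, ANOMALOUS), Frobenius witness `ℓ = 13`: `ℓ ∤ Δ`, `#Ẽ(𝔽_{13}) = 8`
(`a_{13} = 6`), `X² − a_{13}X + 13` root-free mod `3` (`E[3]` irreducible). Cremona `allbsd`: analytic rank `0`,
`#E(ℚ)_tors = 1`, `∏ c_ℓ = 18`, `#Ш_an = 9`. DISPLAYED: F1 (`hfine`); PUBLISHED `hS`, `hmodP`, `hGZK`, `h3`; census /
certificates `hL`, `hcertA` (MUCERT3), `hcard` (`#Sel^(3)(E/ℚ) = 9`, the two-engine exact `3`-descent of record — the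
same binder as the CTP record `bsdp_t340186p1`), `hq`/`hv` (`ord₃ #Ш_an = 2`). Second road; per pair; nothing booked.
[cite: Kato2004Asterisque, Thm. 12.6 (p. 222), Thm. 17.4 (2), (3) (p. 273) and §17.13 (pp. 279–280)]
[cite: SilvermanAEC2009, Thm. X.4.2 (a)] [cite: Mazur1978, §6 Prop. 6.3 (1) (p. 153)]
[cite: Miller2011LMS, Def. 1.1 (arXiv:1010.2431 p. 3)] [cite: Cremona2006, Table 1 (Cremona label 340186p1)] -/
theorem bsdp_three_sha_e340186p1_of_fine
    (hfine : exists_divisibilityInputs_fineQuotient_zeta)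
    (hS : Schneider1985_order_charGenerator_odd) (hmodP : nonempty_modularParametrizationData)
    (hGZK : rank_eq_analyticRank_of_analyticRank_le_one) (h3 : realPeriodRat_eq_unit_mul_plusPeriod_three)
    (W : WeierstrassCurve ℚ) [W.IsElliptic] [W.IsGloballyMinimal]
    (hI : integralModelInt W = ⟨1, 0, 0, (-13183358), (-18680240740)⟩) (hL : W.entireLFunction 1 ≠ 0)
    (hcertA : ∀ {N : ℕ} [NeZero N] (f : CuspForm (Gamma0 N) 2), IsNewformOf W f →
      ∃ n : ℕ, ‖PowerSeries.coeff n (padicLFunction f (unitRoot W 3 : ℚ_[3]))‖ = 1)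
    (hcard : Nat.card (W.selmerGroup (3 : ℤ)) = 9)
    {q : ℚ} (hq : shaAn W = (q : ℂ)) (hv : padicValRat 3 q = 2) : BSDp W 3 :=
  haveI : Fact (Nat.Prime 13) := ⟨by norm_num⟩
  bsdp_three_shaCell_of_ainvs_of_fine_of_card_selmerThree hfine hS hmodP hGZK h3 1 0 0 (-13183358) (-18680240740) hI
    13 8 3 (by decide +kernel) (by decide +kernel) (by decide) (by decide) (by decide) (by decide +kernel)
    (by decide +kernel) (by decide +kernel) hL hcertA hcard hq hv.le

/-! ### `427130j1` (3Ns, `N = 427130 = 2·5·11^2·353`, analytic rank `0`, `#Ш_an = 9` — Ш-CELL) -/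

/-- **`BSD(E,3)` AT THE PAIR `(427130j1, 3)` MODULO F1 + PUBLISHED FACTS + CERTIFICATES — Ш-cell on the F1 road**
(`MuZeroRoad.bsdp_three_shaCell_of_ainvs_of_fine_of_card_selmerThree`: F1 upper half + ONE exact `3`-descent lower
half; NO CTP pairing certificate). Cremona model `[1, 1, 0, -2255337878, -41220294842668]`, `N = 427130 = 2·5·11^2·353`, census image `3Ns`; IN THE KERNEL:
`3 ∤ Δ`, `#Ẽ(𝔽₃) = 2` (`a₃ = 2`: good ORDINARY), Frobenius witness `ℓ = 7`: `ℓ ∤ Δ`, `#Ẽ(𝔽_{7}) = 5`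
(`a_{7} = 3`), `X² − a_{7}X + 7` root-free mod `3` (`E[3]` irreducible). Cremona `allbsd`: analytic rank `0`,
`#E(ℚ)_tors = 1`, `∏ c_ℓ = 12`, `#Ш_an = 9`. DISPLAYED: F1 (`hfine`); PUBLISHED `hS`, `hmodP`, `hGZK`, `h3`; census /
certificates `hL`, `hcertA` (MUCERT3), `hcard` (`#Sel^(3)(E/ℚ) = 9`, the two-engine exact `3`-descent of record — the
same binder as the CTP record `bsdp_t427130j1`), `hq`/`hv` (`ord₃ #Ш_an = 2`). Second road; per pair; nothing booked.
[cite: Kato2004Asterisque, Thm. 12.6 (p. 222), Thm. 17.4 (2), (3) (p. 273) and §17.13 (pp. 279–280)]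
[cite: SilvermanAEC2009, Thm. X.4.2 (a)] [cite: Mazur1978, §6 Prop. 6.3 (1) (p. 153)]
[cite: Miller2011LMS, Def. 1.1 (arXiv:1010.2431 p. 3)] [cite: Cremona2006, Table 1 (Cremona label 427130j1)] -/
theorem bsdp_three_sha_e427130j1_of_fine
    (hfine : exists_divisibilityInputs_fineQuotient_zeta)
    (hS : Schneider1985_order_charGenerator_odd) (hmodP : nonempty_modularParametrizationData)
    (hGZK : rank_eq_analyticRank_of_analyticRank_le_one) (h3 : realPeriodRat_eq_unit_mul_plusPeriod_three)
    (W : WeierstrassCurve ℚ) [W.IsElliptic] [W.IsGloballyMinimal]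
    (hI : integralModelInt W = ⟨1, 1, 0, (-2255337878), (-41220294842668)⟩) (hL : W.entireLFunction 1 ≠ 0)
    (hcertA : ∀ {N : ℕ} [NeZero N] (f : CuspForm (Gamma0 N) 2), IsNewformOf W f →
      ∃ n : ℕ, ‖PowerSeries.coeff n (padicLFunction f (unitRoot W 3 : ℚ_[3]))‖ = 1)
    (hcard : Nat.card (W.selmerGroup (3 : ℤ)) = 9)
    {q : ℚ} (hq : shaAn W = (q : ℂ)) (hv : padicValRat 3 q = 2) : BSDp W 3 :=
  haveI : Fact (Nat.Prime 7) := ⟨by norm_num⟩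
  bsdp_three_shaCell_of_ainvs_of_fine_of_card_selmerThree hfine hS hmodP hGZK h3 1 1 0 (-2255337878) (-41220294842668) hI
    7 5 2 (by decide +kernel) (by decide +kernel) (by decide) (by decide) (by decide) (by decide +kernel)
    (by decide +kernel) (by decide +kernel) hL hcertA hcard hq hv.le

end Summit.BirchSwinnertonDyer.Rank1Residual.X10.MuZeroRoad

end
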